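import Summits.HodgeConjecture.HodgeConjecture.Theorems.CYFormCasimirCYFormCarrierEightGeneralFrame
import Summits.HodgeConjecture.HodgeConjecture.Theorems.CYFormCasimirCYFormCarrierEightCoeffTwist
import Literature.AlgebraicGeometry.HodgeTheory.CoefficientRingHomTwist
import HarnessLib

/-!
# Crux X1 `CYFormCarrierEight` (route `CYFormCasimir`, stmt-HodgeConjecture-23493), helper file 19:
# preparations for the Lagrangian step — twists of iterated products, wedges in a `4`-space, the eigen-projectors,
# a conjugation-type automorphism, dimension transport, adapted Weil frames

research route conditional on HC_CM; not a corollary. Nothing here proves HC, HC_CM, the rung H2, X1 or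
`stub_cyform_exists`; step S4 of `Cruxes/CYFormCarrierEight/STUB-PLAN-stub_cyform_exists.md` (the norm condition
`⋆⋆ ∈ Nm(K^×)` from HYPERBOLICITY, via the `K`-stable Lagrangian subspace of `IsHyperbolicWeilType`).

* `coeffClass_cupPowOne` — `σ_*(v₁ ∪ ⋯ ∪ v_m) = σ_* v₁ ∪ ⋯ ∪ σ_* v_m`;
* `exists_smul_cupPowOne_of_mem_span` — if `g₁, …, g_m` lie in the span of `f₁, …, f_m` then `g₁ ∪ ⋯ ∪ g_m` is a multiple
  of `f₁ ∪ ⋯ ∪ f_m` (multilinear expansion; alternating);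
* `exists_ringEquiv_apply_I_mul_sqrt_eq_neg` — an automorphism of `ℂ` with `σ(i√d) = -i√d` (complex conjugation);
* `finrank_le_of_coeffClass_mapsTo` — a coefficient twist mapping `P` into `Q` forces `dim P ≤ dim Q` (semilinear transport
  of linear independence);
* `projPlus_mem_eigW`, `projMinus_mem_eigWbar`, `projPlus_add_projMinus`, `coeffClass_projPlus_of_fix/of_swap` — the
  eigen-projectors `p± = (2i√d)⁻¹(± φ^* + i√d)`-type formulas with coefficients in `K = ℚ(i√d)` and their Galois behaviour;
* `exists_weilFrame_extending` — four independent vectors of `W` are the first four vectors of some basis of `W`;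
* `monB_weilBasis_firstQuad`, `monB_weilBasis_lastQuadDual` — the corresponding monomials `w_{I₀}`, `w^*_{I₀ᶜ}` as iterated
  products.

References: vanGeemen1994HodgeAV (Lemma 5.2, 5.4, proof of Thm. 6.12), Deligne1982HodgeCycles (I §3), HatcherAT2002 (§3.2).
-/

-- `Summit.HodgeConjecture.HodgeConjecture.…` is the tree's mandated summit/problem namespace (single-problem summit).
set_option linter.dupNamespace false
noncomputable section

open CategoryTheory
open Literature.AlgebraicTopology.SingularHomology
open Literature.AlgebraicGeometry.Motives
open Literature.AlgebraicGeometry.HodgeTheory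
open Literature.AlgebraicGeometry.VanGeemen1994

namespace Summit.HodgeConjecture.HodgeConjecture.Theorems.CYFormCarrier

/-! ## §1 Coefficient twists of iterated products -/

section Twist

variable {A : AbelianVariety ℂ} (τ : ℂ →+* ℂ)

/-- **`σ_*(v₁ ∪ ⋯ ∪ v_m) = σ_* v₁ ∪ ⋯ ∪ σ_* v_m`** (`σ_*` is multiplicative and `σ_* 1 = 1`). [cite: HatcherAT2002, §3.2 Prop. 3.10] -/
theorem coeffClass_cupPowOne (m : ℕ) (v : Fin m → complexBetti A.X 1) :
    coeffClass (R := ℂ) (S := ℂ) τ.toAddMonoidHom m (cupPowOne ℂ (ComplexPoints A.X) m v) =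
      cupPowOne ℂ (ComplexPoints A.X) m (fun i ↦ coeffClass (R := ℂ) (S := ℂ) τ.toAddMonoidHom 1 (v i)) := by
  induction m with
  | zero =>
    rw [cupPowOne_zero, cupPowOne_zero]
    exact coeffClass_ringHom_one τ
  | succ m ih =>
    rw [cupPowOne_succ, cupPowOne_succ, coeffClass_ringHom_cupProduct, ih]
    rfl

end Twist

/-! ## §2 Iterated products of vectors in the span of `m` given vectors -/

section Wedge

variable {A : AbelianVariety ℂ}

/-- **A wedge of `m` vectors from an `m`-dimensional span is a multiple of the wedge of the spanning vectors**:
if `g r ∈ span{f₀, …, f_{m-1}}` for all `r` then `g₀ ∪ ⋯ ∪ g_{m-1} = δ · (f₀ ∪ ⋯ ∪ f_{m-1})` for some `δ`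
(expand multilinearly; terms with a repeated `f` vanish, the others are `± f₀ ∪ ⋯ ∪ f_{m-1}`).
[cite: LangeBirkenhake1992, Lemma 1.1.17] -/
theorem exists_smul_cupPowOne_of_mem_span {m : ℕ} (f g : Fin m → complexBetti A.X 1)
    (hg : ∀ r, g r ∈ Submodule.span ℂ (Set.range f)) :
    ∃ δ : ℂ, cupPowOne ℂ (ComplexPoints A.X) m g = δ • cupPowOne ℂ (ComplexPoints A.X) m f := by
  classical
  choose M hM using fun r ↦ (Submodule.mem_span_range_iff_exists_fun ℂ).1 (hg r)
  -- each term of the multilinear expansion is a multiple of `f₀ ∪ ⋯ ∪ f_{m-1}`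
  have hterm : ∀ p : Fin m → Fin m, ∃ ε : ℂ,
      cupPowOne ℂ (ComplexPoints A.X) m (fun r ↦ M r (p r) • f (p r)) = ε • cupPowOne ℂ (ComplexPoints A.X) m f := by
    intro p
    rw [← cupPowOneAlt_apply, AlternatingMap.map_smul_univ]
    by_cases hp : Function.Injective p
    · set σ : Equiv.Perm (Fin m) := Equiv.ofBijective p (Finite.injective_iff_bijective.1 hp) with hσ
      have hpσ : (fun r ↦ f (p r)) = f ∘ σ := rfl
      refine ⟨(∏ r, M r (p r)) * (Equiv.Perm.sign σ : ℂ), ?_⟩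
      rw [hpσ, AlternatingMap.map_perm, cupPowOneAlt_apply, Units.smul_def, ← Int.cast_smul_eq_zsmul ℂ, smul_smul]
    · refine ⟨0, ?_⟩
      rw [AlternatingMap.map_eq_zero_of_not_injective _ (fun r ↦ f (p r))
        (fun h ↦ hp (Function.Injective.of_comp h)), smul_zero, zero_smul]
  choose ε hε using hterm
  refine ⟨∑ p : Fin m → Fin m, ε p, ?_⟩
  have hg' : g = fun r ↦ ∑ j, M r j • f j := by funext r; exact (hM r).symm
  rw [hg', MultilinearMap.map_sum (cupPowOne ℂ (ComplexPoints A.X) m) (fun r j ↦ M r j • f j)]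
  simp only [hε]
  rw [Finset.sum_smul]

end Wedge

/-! ## §3 An automorphism of `ℂ` moving `i√d`; dimension transport along a coefficient twist -/

section Conj

/-- Complex conjugation is an automorphism of `ℂ` with `σ(i√d) = -i√d`. [folklore] -/
theorem exists_ringEquiv_apply_I_mul_sqrt_eq_neg (d : ℕ) :
    ∃ κ : ℂ ≃+* ℂ, κ (Complex.I * (Real.sqrt d : ℂ)) = -(Complex.I * (Real.sqrt d : ℂ)) := by
  refine ⟨starRingAut, ?_⟩
  rw [starRingAut_apply, star_mul', Complex.star_def, Complex.conj_I, Complex.conj_ofReal, neg_mul]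

variable {A : AbelianVariety ℂ}

/-- **Dimension transport along a coefficient twist**: if `σ_*` maps the subspace `P ⊆ Hᵏ(A(ℂ); ℂ)` into `Q` then
`dim P ≤ dim Q` (`σ_*` is injective and semilinear, so it carries a basis of `P` to a linearly independent family in `Q`).
[cite: Deligne1982HodgeCycles, I §3] -/
theorem finrank_le_of_coeffClass_mapsTo (σ : ℂ ≃+* ℂ) {k : ℕ} (P Q : Submodule ℂ (complexBetti A.X k))
    (h : ∀ x ∈ P, coeffClass (R := ℂ) (S := ℂ) σ.toRingHom.toAddMonoidHom k x ∈ Q) :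
    Module.finrank ℂ P ≤ Module.finrank ℂ Q := by
  haveI := finite_complexBetti_abelianVariety A k
  set b := Module.finBasis ℂ P with hb
  -- the transported family in `Q`
  set fam : Fin (Module.finrank ℂ P) → Q := fun i ↦ ⟨coeffClass (R := ℂ) (S := ℂ) σ.toRingHom.toAddMonoidHom k (b i), h _ (b i).2⟩
    with hfam
  have hli0 : LinearIndependent ℂ (P.subtype ∘ b) := b.linearIndependent.map' P.subtype P.ker_subtype
  have hli1 : LinearIndependent ℂ ((coeffClass (R := ℂ) (S := ℂ) σ.toRingHom.toAddMonoidHom k) ∘ (P.subtype ∘ b)) := by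
    refine hli0.map_of_injective_injective (fun r ↦ σ.symm r) (coeffClass (R := ℂ) (S := ℂ) σ.toRingHom.toAddMonoidHom k)
      (fun r hr ↦ by simpa using hr) (fun m hm ↦ coeffClass_ringEquiv_injective σ k (by rw [hm, map_zero]))
      (fun r m ↦ ?_)
    rw [coeffClass_ringHom_smul]
    change σ (σ.symm r) • _ = _
    rw [RingEquiv.apply_symm_apply]
  have hli : LinearIndependent ℂ fam := by
    refine LinearIndependent.of_comp Q.subtype ?_
    exact hli1
  have hcard := hli.fintype_card_le_finrank
  rwa [Fintype.card_fin] at hcard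

end Conj

/-! ## §4 The eigen-projectors with coefficients in `K = ℚ(i√d)` -/

section Proj

variable {A : AbelianVariety ℂ} {d : ℕ} {φ : A ⟶ A} (hd : 0 < d) (hφ : φ ≫ φ = -(d • 𝟙 A))

include hφ in
/-- `p₊ c := (2i√d)⁻¹ (φ^* c + i√d · c)` lies in `W = ker(φ^* - i√d)`. [cite: vanGeemen1994HodgeAV, proof of Lemma 5.2] -/
theorem projPlus_mem_eigW (c : complexBetti A.X 1) :
    (2 * (Complex.I * (Real.sqrt d : ℂ)))⁻¹ • (pullbackOne A φ c + (Complex.I * (Real.sqrt d : ℂ)) • c) ∈ eigW A φ d := by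
  set s : ℂ := Complex.I * (Real.sqrt d : ℂ) with hs
  have hT2 : ∀ c, pullbackOne A φ (pullbackOne A φ c) = -((d : ℂ) • c) := fun c ↦ complexBetti_map_map_one_of_comp_self hφ c
  have hs2 : s * s = -(d : ℂ) := by rw [← sq, hs, I_mul_sqrt_sq]
  refine Submodule.smul_mem _ _ ?_
  change pullbackOne A φ c + s • c ∈ Module.End.eigenspace (pullbackOne A φ) s
  rw [Module.End.mem_eigenspace_iff, map_add, map_smul, hT2, smul_add, smul_smul, hs2, neg_smul, add_comm]

include hφ in
/-- `p₋ c := (2i√d)⁻¹ (i√d · c - φ^* c)` lies in `W^* = ker(φ^* + i√d)`. [cite: vanGeemen1994HodgeAV, proof of Lemma 5.2] -/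
theorem projMinus_mem_eigWbar (c : complexBetti A.X 1) :
    (2 * (Complex.I * (Real.sqrt d : ℂ)))⁻¹ • ((Complex.I * (Real.sqrt d : ℂ)) • c - pullbackOne A φ c) ∈ eigWbar A φ d := by
  set s : ℂ := Complex.I * (Real.sqrt d : ℂ) with hs
  have hT2 : ∀ c, pullbackOne A φ (pullbackOne A φ c) = -((d : ℂ) • c) := fun c ↦ complexBetti_map_map_one_of_comp_self hφ c
  have hs2 : s * s = -(d : ℂ) := by rw [← sq, hs, I_mul_sqrt_sq]
  refine Submodule.smul_mem _ _ ?_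
  change s • c - pullbackOne A φ c ∈ Module.End.eigenspace (pullbackOne A φ) (-s)
  rw [Module.End.mem_eigenspace_iff, map_sub, map_smul, hT2, smul_sub, smul_smul, neg_mul, hs2, neg_neg, neg_smul,
    sub_neg_eq_add, sub_neg_eq_add, add_comm]

include hd in
/-- `p₊ c + p₋ c = c`. [folklore] -/
theorem projPlus_add_projMinus (c : complexBetti A.X 1) :
    (2 * (Complex.I * (Real.sqrt d : ℂ)))⁻¹ • (pullbackOne A φ c + (Complex.I * (Real.sqrt d : ℂ)) • c) +
      (2 * (Complex.I * (Real.sqrt d : ℂ)))⁻¹ • ((Complex.I * (Real.sqrt d : ℂ)) • c - pullbackOne A φ c) = c := by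
  have hs0 : (2 * (Complex.I * (Real.sqrt d : ℂ))) ≠ 0 := mul_ne_zero two_ne_zero (I_mul_sqrt_ne_zero hd)
  have e : pullbackOne A φ c + (Complex.I * (Real.sqrt d : ℂ)) • c + ((Complex.I * (Real.sqrt d : ℂ)) • c - pullbackOne A φ c) =
      (2 * (Complex.I * (Real.sqrt d : ℂ))) • c := by
    rw [show (2 * (Complex.I * (Real.sqrt d : ℂ))) • c = (Complex.I * (Real.sqrt d : ℂ)) • c + (Complex.I * (Real.sqrt d : ℂ)) • c
      from by rw [mul_smul, two_smul]]
    abel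
  rw [← smul_add, e, smul_smul, inv_mul_cancel₀ hs0, one_smul]

variable (σ : ℂ ≃+* ℂ)

/-- **`σ_*` fixes `p₊ r` for a rational class `r` when `σ(i√d) = i√d`.** [cite: Deligne1982HodgeCycles, I §3] -/
theorem coeffClass_projPlus_of_fix (hσ : σ (Complex.I * (Real.sqrt d : ℂ)) = Complex.I * (Real.sqrt d : ℂ))
    {r : complexBetti A.X 1} (hr : IsRationalClass r) :
    coeffClass (R := ℂ) (S := ℂ) σ.toRingHom.toAddMonoidHom 1
        ((2 * (Complex.I * (Real.sqrt d : ℂ)))⁻¹ • (pullbackOne A φ r + (Complex.I * (Real.sqrt d : ℂ)) • r)) =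
      (2 * (Complex.I * (Real.sqrt d : ℂ)))⁻¹ • (pullbackOne A φ r + (Complex.I * (Real.sqrt d : ℂ)) • r) := by
  have hr' := hr.coeffClass_ringHom_eq σ.toRingHom
  rw [coeffClass_ringHom_smul, map_add, coeffClass_ringHom_smul]
  change σ _ • (coeffClass (R := ℂ) (S := ℂ) σ.toRingHom.toAddMonoidHom 1 (complexBetti.map φ.hom.hom.hom 1 r) + σ _ • _) = _
  rw [coeffClass_map, hr', map_inv₀, map_mul, hσ, map_ofNat]

/-- **`σ_*` maps `p₊ r` to `p₋ r` for a rational class `r` when `σ(i√d) = -i√d`.** [cite: Deligne1982HodgeCycles, I §3] -/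
theorem coeffClass_projPlus_of_swap (hσ : σ (Complex.I * (Real.sqrt d : ℂ)) = -(Complex.I * (Real.sqrt d : ℂ)))
    {r : complexBetti A.X 1} (hr : IsRationalClass r) :
    coeffClass (R := ℂ) (S := ℂ) σ.toRingHom.toAddMonoidHom 1
        ((2 * (Complex.I * (Real.sqrt d : ℂ)))⁻¹ • (pullbackOne A φ r + (Complex.I * (Real.sqrt d : ℂ)) • r)) =
      (2 * (Complex.I * (Real.sqrt d : ℂ)))⁻¹ • ((Complex.I * (Real.sqrt d : ℂ)) • r - pullbackOne A φ r) := by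
  have hr' := hr.coeffClass_ringHom_eq σ.toRingHom
  rw [coeffClass_ringHom_smul, map_add, coeffClass_ringHom_smul]
  change σ _ • (coeffClass (R := ℂ) (S := ℂ) σ.toRingHom.toAddMonoidHom 1 (complexBetti.map φ.hom.hom.hom 1 r) + σ _ • _) = _
  rw [coeffClass_map, hr', map_inv₀, map_mul, hσ, map_ofNat]
  change (2 * -(Complex.I * (Real.sqrt d : ℂ)))⁻¹ • (pullbackOne A φ r + -(Complex.I * (Real.sqrt d : ℂ)) • r) = _
  rw [mul_neg, inv_neg, neg_smul, ← smul_neg, neg_add', neg_smul, sub_neg_eq_add, add_comm, ← sub_eq_add_neg]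

/-- **`σ_*` maps `p₋ r` to `p₊ r` for a rational class `r` when `σ(i√d) = -i√d`.** [cite: Deligne1982HodgeCycles, I §3] -/
theorem coeffClass_projMinus_of_swap (hσ : σ (Complex.I * (Real.sqrt d : ℂ)) = -(Complex.I * (Real.sqrt d : ℂ)))
    {r : complexBetti A.X 1} (hr : IsRationalClass r) :
    coeffClass (R := ℂ) (S := ℂ) σ.toRingHom.toAddMonoidHom 1
        ((2 * (Complex.I * (Real.sqrt d : ℂ)))⁻¹ • ((Complex.I * (Real.sqrt d : ℂ)) • r - pullbackOne A φ r)) =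
      (2 * (Complex.I * (Real.sqrt d : ℂ)))⁻¹ • (pullbackOne A φ r + (Complex.I * (Real.sqrt d : ℂ)) • r) := by
  have hr' := hr.coeffClass_ringHom_eq σ.toRingHom
  rw [coeffClass_ringHom_smul, map_sub, coeffClass_ringHom_smul]
  change σ _ • (σ _ • _ - coeffClass (R := ℂ) (S := ℂ) σ.toRingHom.toAddMonoidHom 1 (complexBetti.map φ.hom.hom.hom 1 r)) = _
  rw [coeffClass_map, hr', map_inv₀, map_mul, hσ, map_ofNat]
  change (2 * -(Complex.I * (Real.sqrt d : ℂ)))⁻¹ • (-(Complex.I * (Real.sqrt d : ℂ)) • r - pullbackOne A φ r) = _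
  rw [mul_neg, inv_neg, neg_smul, ← smul_neg, neg_sub, neg_smul, sub_neg_eq_add]

/-- **`σ_*` fixes `p₋ r` for a rational class `r` when `σ(i√d) = i√d`.** [cite: Deligne1982HodgeCycles, I §3] -/
theorem coeffClass_projMinus_of_fix (hσ : σ (Complex.I * (Real.sqrt d : ℂ)) = Complex.I * (Real.sqrt d : ℂ))
    {r : complexBetti A.X 1} (hr : IsRationalClass r) :
    coeffClass (R := ℂ) (S := ℂ) σ.toRingHom.toAddMonoidHom 1
        ((2 * (Complex.I * (Real.sqrt d : ℂ)))⁻¹ • ((Complex.I * (Real.sqrt d : ℂ)) • r - pullbackOne A φ r)) =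
      (2 * (Complex.I * (Real.sqrt d : ℂ)))⁻¹ • ((Complex.I * (Real.sqrt d : ℂ)) • r - pullbackOne A φ r) := by
  have hr' := hr.coeffClass_ringHom_eq σ.toRingHom
  rw [coeffClass_ringHom_smul, map_sub, coeffClass_ringHom_smul]
  change σ _ • (σ _ • _ - coeffClass (R := ℂ) (S := ℂ) σ.toRingHom.toAddMonoidHom 1 (complexBetti.map φ.hom.hom.hom 1 r)) = _
  rw [coeffClass_map, hr', map_inv₀, map_mul, hσ, map_ofNat]

end Proj

/-! ## §5 Weil frames extending four given independent vectors of `W` -/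

section Frame

variable {A : AbelianVariety ℂ} {d : ℕ} {φ : A ⟶ A}
variable (hd : 0 < d) (hA : A.dim = 2 * 4) (hφ : φ ≫ φ = -(d • 𝟙 A))

include hd hA hφ in
/-- **Four independent vectors of `W` extend to a basis of `W`** indexed by `Fin 8`, occupying the first four places.
[cite: vanGeemen1994HodgeAV, proof of Thm. 6.12] -/
theorem exists_weilFrame_extending (y : Fin 4 → complexBetti A.X 1) (hyW : ∀ r, y r ∈ eigW A φ d)
    (hli : LinearIndependent ℂ y) :
    ∃ w : Module.Basis (Fin (2 * 4)) ℂ (eigW A φ d), ∀ r : Fin 4, (w (Fin.castAdd 4 r) : complexBetti A.X 1) = y r := by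
  haveI := finite_complexBetti_abelianVariety A 1
  set y' : Fin 4 → eigW A φ d := fun r ↦ ⟨y r, hyW r⟩ with hy'
  have hli' : LinearIndependent ℂ y' := LinearIndependent.of_comp (eigW A φ d).subtype hli
  set U := Submodule.span ℂ (Set.range y') with hU
  set bU := Module.Basis.span hli' with hbU
  obtain ⟨C, hC⟩ := Submodule.exists_isCompl U
  have hfinW : Module.finrank ℂ (eigW A φ d) = 2 * 4 := finrank_eigW hd hφ hA
  have hfinU : Module.finrank ℂ U = 4 := by rw [hU, finrank_span_eq_card hli', Fintype.card_fin]
  have hfinC : Module.finrank ℂ C = 4 := by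
    have h := Submodule.finrank_add_eq_of_isCompl hC
    rw [hfinU, hfinW] at h
    omega
  set bC := Module.finBasisOfFinrankEq ℂ C hfinC with hbC
  refine ⟨((bU.prod bC).map (Submodule.prodEquivOfIsCompl U C hC)).reindex finSumFinEquiv, fun r ↦ ?_⟩
  rw [Module.Basis.reindex_apply, finSumFinEquiv_symm_apply_castAdd, Module.Basis.map_apply, Module.Basis.prod_apply,
    Sum.elim_inl, Function.comp_apply, LinearMap.inl_apply, Submodule.coe_prodEquivOfIsCompl', Submodule.coe_zero, add_zero,
    hbU, Module.Basis.span_apply]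

variable (e : ProjectiveEmbedding A.X) {a : complexBetti (projectiveSpace e.n ℂ) 2} (ha : IsRationalClass a) (ha0 : a ≠ 0)
  (w : Module.Basis (Fin (2 * 4)) ℂ (eigW A φ d))
  (b : Module.Basis (Fin (2 * 4 + 2 * 4)) ℂ (complexBetti A.X 1))
  (hb : b = weilBasis (m := 2 * 4 - 1) (k := 2 * 4) (by omega) (by omega) hd hφ e ha ha0 w)

/-- The index set `I₀ = {0,1,2,3} ⊂ Fin 8` of the first quadruple. [folklore] -/
theorem card_map_castAddEmb_univ_four :
    ((Finset.univ : Finset (Fin 4)).map (Fin.castAddEmb 4)).card = 2 * 2 := by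
  rw [Finset.card_map, Finset.card_univ, Fintype.card_fin]

/-- The complement of `I₀ = castAdd(univ)` in `Fin 8` is `natAdd(univ)`. [folklore] -/
theorem compl_firstQuad (hqk : 2 * 2 + 2 * 2 = Fintype.card (Fin (2 * 4))) :
    Set.powersetCard.compl hqk (Set.powersetCard.ofCard card_map_castAddEmb_univ_four : Set.powersetCard (Fin (2 * 4)) (2 * 2)) =
      Set.powersetCard.ofCard (s := (Finset.univ : Finset (Fin 4)).map (Fin.natAddEmb 4))
        (by rw [Finset.card_map, Finset.card_univ, Fintype.card_fin]) := by
  apply Subtype.ext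
  rw [Set.powersetCard.coe_compl]
  change ((Finset.univ : Finset (Fin 4)).map (Fin.castAddEmb 4))ᶜ = (Finset.univ : Finset (Fin 4)).map (Fin.natAddEmb 4)
  ext p
  rw [Finset.mem_compl]
  refine Fin.addCases (fun i ↦ ?_) (fun j ↦ ?_) p
  · constructor
    · intro h; exact absurd (Finset.mem_map_of_mem (Fin.castAddEmb 4) (Finset.mem_univ i)) h
    · intro h
      exfalso
      obtain ⟨j, -, hj⟩ := Finset.mem_map.1 h
      have h' := congrArg Fin.val hj
      simp only [Fin.natAddEmb_apply, Fin.val_natAdd, Fin.val_castAdd] at h'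
      omega
  · constructor
    · intro _; exact Finset.mem_map_of_mem (Fin.natAddEmb 4) (Finset.mem_univ j)
    · intro _ h
      obtain ⟨i, -, hi⟩ := Finset.mem_map.1 h
      have h' := congrArg Fin.val hi
      simp only [Fin.castAddEmb_apply, Fin.val_castAdd, Fin.val_natAdd] at h'
      omega

include hb in
/-- **The monomial `w_{I₀}` of the first quadruple is `w₀ ∪ w₁ ∪ w₂ ∪ w₃`.** [cite: vanGeemen1994HodgeAV, proof of Thm. 6.12] -/
theorem monB_weilBasis_firstQuad :
    monB b (2 * 2) (Set.powersetCard.map (2 * 2) (Fin.castAddEmb (2 * 4))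
        (Set.powersetCard.ofCard card_map_castAddEmb_univ_four)) =
      cupPowOne ℂ (ComplexPoints A.X) (2 * 2) (fun r : Fin (2 * 2) ↦ (w (Fin.castAdd 4 r) : complexBetti A.X 1)) := by
  rw [monB_apply]
  have hmono : StrictMono (fun r : Fin (2 * 2) ↦ Fin.castAdd (2 * 4) (Fin.castAdd 4 r)) := by
    intro x y hxy
    rw [Fin.lt_def] at hxy ⊢
    simp only [Fin.val_castAdd]
    exact hxy
  have hmem : ∀ r : Fin (2 * 2), Fin.castAdd (2 * 4) (Fin.castAdd 4 r) ∈
      (Set.powersetCard.map (2 * 2) (Fin.castAddEmb (2 * 4))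
        (Set.powersetCard.ofCard card_map_castAddEmb_univ_four : Set.powersetCard (Fin (2 * 4)) (2 * 2))).val := by
    intro r
    rw [Set.powersetCard.val_map, Set.powersetCard.val_ofCard]
    exact Finset.mem_map_of_mem _ (Finset.mem_map_of_mem _ (Finset.mem_univ r))
  have h := Finset.orderEmbOfFin_unique (Set.powersetCard.map (2 * 2) (Fin.castAddEmb (2 * 4))
    (Set.powersetCard.ofCard card_map_castAddEmb_univ_four : Set.powersetCard (Fin (2 * 4)) (2 * 2))).prop hmem hmono
  congr 1
  funext r
  rw [← h, hb, weilBasis_castAdd]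

/-- **The dual monomial `w^*_{I₀ᶜ}` of the last quadruple is `w^*₄ ∪ w^*₅ ∪ w^*₆ ∪ w^*₇`.** [cite: vanGeemen1994HodgeAV, proof of Thm. 6.12] -/
theorem monB_weilBasis_lastQuadDual :
    monB b (2 * 2) (Set.powersetCard.map (2 * 2) (Fin.natAddEmb (2 * 4))
        (Set.powersetCard.ofCard (s := (Finset.univ : Finset (Fin 4)).map (Fin.natAddEmb 4))
          (by rw [Finset.card_map, Finset.card_univ, Fintype.card_fin]) : Set.powersetCard (Fin (2 * 4)) (2 * 2))) =
      cupPowOne ℂ (ComplexPoints A.X) (2 * 2) (fun r : Fin (2 * 2) ↦ b (Fin.natAdd (2 * 4) (Fin.natAdd 4 r))) := by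
  rw [monB_apply]
  have hmono : StrictMono (fun r : Fin (2 * 2) ↦ Fin.natAdd (2 * 4) (Fin.natAdd 4 r)) := by
    intro x y hxy
    rw [Fin.lt_def] at hxy ⊢
    simp only [Fin.val_natAdd]
    omega
  have hmem : ∀ r : Fin (2 * 2), Fin.natAdd (2 * 4) (Fin.natAdd 4 r) ∈
      (Set.powersetCard.map (2 * 2) (Fin.natAddEmb (2 * 4))
        (Set.powersetCard.ofCard (s := (Finset.univ : Finset (Fin 4)).map (Fin.natAddEmb 4))
          (by rw [Finset.card_map, Finset.card_univ, Fintype.card_fin]) : Set.powersetCard (Fin (2 * 4)) (2 * 2))).val := by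
    intro r
    rw [Set.powersetCard.val_map, Set.powersetCard.val_ofCard]
    exact Finset.mem_map_of_mem _ (Finset.mem_map_of_mem _ (Finset.mem_univ r))
  have h := Finset.orderEmbOfFin_unique (Set.powersetCard.map (2 * 2) (Fin.natAddEmb (2 * 4))
    (Set.powersetCard.ofCard (s := (Finset.univ : Finset (Fin 4)).map (Fin.natAddEmb 4))
      (by rw [Finset.card_map, Finset.card_univ, Fintype.card_fin]) : Set.powersetCard (Fin (2 * 4)) (2 * 2))).prop hmem hmono
  congr 1
  funext r
  rw [← h]

end Frame

end Summit.HodgeConjecture.HodgeConjecture.Theorems.CYFormCarrier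

end
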